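import Mathlib.AlgebraicGeometry.Morphisms.Flat
import Mathlib.FieldTheory.Perfect
import Mathlib.GroupTheory.OrderOfElement
import Literature.AlgebraicGeometry.Motives.Varieties
import Literature.AlgebraicGeometry.Motives.AlgPoints
import Literature.AlgebraicGeometry.Motives.Cycles
import Literature.AlgebraicGeometry.Motives.PreWeilCohomology
import Literature.AlgebraicGeometry.Motives.WeilCohomology
import Literature.AlgebraicGeometry.Motives.BaseChange
import Literature.AlgebraicGeometry.Motives.SubschemeCycles
import Literature.AlgebraicGeometry.Motives.AlgebraicEquivalence
import HarnessLib

-- provenance: harness21/H21/H21/Statements/Hodge/CyclesEquivalences.lean @ 35e4df5 (interim HEAD d8f2665); M5 mechanical rewrite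
/-!
# Hodge family: cycles, Chow groups, flat pull-back and adequate equivalences

Target statements **hodge.S10** and **hodge.S11** of the Hodge family (trunk MotiveL, outline
§3), on top of the preludes `Cycles` (graded cycles `Z_d X`, `Rat_d X`, Chow groups, proper
push-forward), `SubschemeCycles` (fundamental cycles, cycles of closed subschemes, flat
pull-back, base change of cycles) and `AlgebraicEquivalence` (`Alg ≤ Hom ≤ Num`, Griffiths group).

* **hodge.S10** (Fulton, *Intersection Theory*, §§1.3–1.7): "algebraic cycles, rational
  equivalence, Chow groups, proper push-forward and flat pull-back". The cycle / Chow-group /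
  push-forward clauses are the preludes; here we record the *flat pull-back clause*:
  functoriality `(g ∘ f)^* = f^* ∘ g^*` and the push–pull formula `g^* f_* = f'_* g'^*` on Chow
  groups (Fulton Prop. 1.7), the formula `f^*[V] = [f⁻¹(V)]` (Fulton Lemma 1.7.1), pure
  dimensionality of fundamental cycles, and the comparison between the multiplicity-one cycle
  class of `PreWeilCohomology.comap σ W` (prelude `BaseChange`) and the honest base change of
  cycles `AlgebraicCycle.baseChange σ X` (prelude `SubschemeCycles`) over a perfect ground field.
* **hodge.S11** (Fulton Ch. 19; Kleiman 1968 §3): the chain of adequate equivalence relations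
  `Rat ≤ Alg ≤ Hom ≤ Num`, the non-triviality of the Griffiths group (Griffiths 1969) and
  Matsusaka's theorem `Alg ⊗ ℚ = Num ⊗ ℚ` for divisors (Matsusaka 1957), the last two as
  `Prop`-valued statements parametrised by a Weil cohomology theory `W`.

## Design notes

* Mathlib has `AlgebraicCycle`, `AlgebraicGeometry.Flat`, `IsClosedImmersion` (with base-change
  instances), `PerfectField`, `IsOfFinAddOrder`; it has no Chow groups, flat pull-back of cycles,
  adequate equivalence relations or Griffiths groups (searched: `ChowGroup`, `flatPullback`,
  `Griffiths`, `numerically`, `Matsusaka` — nothing), which come from the H21 preludes. The only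
  new definition here is `ClosedSubscheme.preimage` (the scheme-theoretic inverse image
  `f⁻¹(V) = V ×_Y X ↪ X`, a Mathlib `pullback` with its base-change closed-immersion instance),
  needed to state Fulton's Lemma 1.7.1.
* `GriffithsGroupNontrivialStatement` is phrased for an arbitrary Weil cohomology theory `W` on
  `ℂ`-schemes with `ℚ`-coefficients, without hypersurface vocabulary: Griffiths' example is a
  general quintic threefold (`n = 3`, `p = 2`, `d = 1`) for Betti cohomology.
* `MatsusakaStatement W` is a `Prop` (not asserted): numerical equivalence is computed through
  `W` (`WeilCohomology.numTrivial`), and its agreement with intersection numbers is not among the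
  axioms of `Literature.AlgebraicGeometry.Motives.WeilCohomology`.
* (D-0014.) The preludes take their unproved ingredients as explicit
  hypotheses — `locallyFinsupp_fundamentalCycleFun` (to form `[Z]`), `locallyFinsupp_flatPullbackFun`,
  `flatPullback_mem_cyclesOfDim`, `flatPullback_mem_ratTrivial` (to form `f^*` on `CH_d`; this one is
  deprecated — refuted as stated, see `Literature.AlgebraicGeometry.Motives.SubschemeCycles`, `## Verdict clean-up`),
  `map_mem_ratTrivial` (to form `f_*` on `CH_d`), `ratTrivial_le_algTrivial`,
  `isGenericComponentPoint_iff_isMax` — and so do the statements here; the smooth-projective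
  groups `Hom_d X`, `Num_d X`, `Griff` carry the instance hypothesis `[CompactSpace X.left]`
  (supplied from the named fact `IsSmoothProjective.compactSpace`). Fulton's Lemma 1.7.1
  (`flatPullback_cycle_eq_cycle_preimage`) and the base-change comparison
  (`comap_cycleClass_eq_cycleMap_baseChange`) are recorded as named facts (`def … : Prop`);
  Fulton's Prop. 1.7 on Chow groups is *proved* from the prelude's cycle-level named fact
  `pushforward_flatPullback`.

## References

* W. Fulton, *Intersection Theory* (2nd ed. 1998), §1.7 (Lemma 1.7.1, Prop. 1.7), Ex. 6.1.2,
  §10.3, Ch. 19 (§19.1, §19.3.1, §19.3.4).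
* S. Kleiman, *Algebraic cycles and the Weil conjectures* (1968), §3 (Prop. 3.2).
* P. Griffiths, *On the periods of certain rational integrals I, II*, Ann. of Math. 90 (1969),
  §14.
* T. Matsusaka, *The criteria for algebraic equivalence and the torsion group*,
  Amer. J. Math. 79 (1957), 53–66.
* A. Grothendieck, J. Dieudonné, EGA IV₂ (Publ. Math. IHÉS 24, 1965), 4.6.1 (geometric
  reducedness over perfect fields).
-/

universe u v

open CategoryTheory AlgebraicGeometry Limits Order

noncomputable section

namespace Literature.AlgebraicGeometry.Motives

section Hodge

/-! ### hodge.S10: flat pull-back -/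

section FlatPullback

variable {X Y : Scheme.{u}}

/-- The scheme-theoretic inverse image `f⁻¹(V) = V ×_Y X ↪ X` of a closed subscheme `V ↪ Y`
under a morphism `f : X ⟶ Y`: the base change of `V.ι` along `f` (a closed immersion by
Mathlib's base-change instance). Fulton, *Intersection Theory*, §1.7 ("`f⁻¹(V)` the inverse
image scheme"); Hartshorne II Ex. 3.11(a). [folklore] -/
def ClosedSubscheme.preimage (V : ClosedSubscheme Y) (f : X ⟶ Y) :
    ClosedSubscheme X where
  carrier := pullback V.ι f
  ι := pullback.snd V.ι f
  isClosedImmersion := MorphismProperty.pullback_snd _ _ inferInstance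

/-- The underlying scheme of `f⁻¹(V)` is `V ×_Y X` (by `rfl`). [folklore] -/
lemma ClosedSubscheme.preimage_carrier (V : ClosedSubscheme Y) (f : X ⟶ Y) :
    (V.preimage f).carrier = pullback V.ι f := rfl

/-- The immersion `f⁻¹(V) ↪ X` is the second projection `V ×_Y X ⟶ X` (by `rfl`). [folklore] -/
lemma ClosedSubscheme.preimage_ι (V : ClosedSubscheme Y) (f : X ⟶ Y) :
    (V.preimage f).ι = pullback.snd V.ι f := rfl

/-- A closed subscheme of a locally Noetherian scheme is locally Noetherian (closed immersions
are of finite type; Mathlib `LocallyOfFiniteType.isLocallyNoetherian`). [folklore] -/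
instance ClosedSubscheme.isLocallyNoetherian_carrier [IsLocallyNoetherian X]
    (V : ClosedSubscheme X) : IsLocallyNoetherian V.carrier :=
  LocallyOfFiniteType.isLocallyNoetherian V.ι

/-- **hodge.S10** (flat pull-back clause; Fulton, *Intersection Theory*, Lemma 1.7.1: "If
`f : X → Y` is flat and `Z` a closed subscheme of `Y`, then `f^*[Z] = [f⁻¹(Z)]`"). For a flat
morphism `f : X ⟶ Y` locally of finite type between locally Noetherian schemes and a closed
subscheme `V ↪ Y`, the flat pull-back of the cycle of `V` is the cycle of the inverse image
scheme: `f^*[V] = [f⁻¹(V)]`. Fulton's standing convention (Ch. 1, App. B.1) is schemes of finite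
type over a field; the formal statement is made for flat morphisms locally of finite type between
locally Noetherian schemes, where both sides are defined (prelude `SubschemeCycles`, whose
local-finiteness facts `hf`, `hZ` are explicit hypotheses). Named fact. [cite: Fulton1998, Lemma 1.7.1] -/
def flatPullback_cycle_eq_cycle_preimage : Prop :=
  ∀ {X Y : Scheme.{u}} (f : X ⟶ Y) [Flat f] [LocallyOfFiniteType f]
    [IsLocallyNoetherian X] [IsLocallyNoetherian Y] (hf : locallyFinsupp_flatPullbackFun.{u})
    (hZ : locallyFinsupp_fundamentalCycleFun.{u}) (V : ClosedSubscheme Y),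
    flatPullback f hf (V.cycle hZ) = (V.preimage f).cycle hZ

/-- **hodge.S10** (Fulton, *Intersection Theory*, §1.5 and Lemma 1.7.2). The fundamental cycle
of a locally Noetherian scheme `Z` all of whose irreducible components have dimension `d` (every
maximal point for the specialisation order has `Order.height = d`) is a `d`-cycle:
`[Z] ∈ Z_d Z`. Uses the named fact `isGenericComponentPoint_iff_isMax Z` (Artinian local rings sit at
the generic points of components) as the hypothesis `hgen`. [folklore] -/
theorem mem_cyclesOfDim_fundamentalCycle (Z : Scheme.{u}) [IsLocallyNoetherian Z]
    (hfin : locallyFinsupp_fundamentalCycleFun.{u}) (hgen : isGenericComponentPoint_iff_isMax Z)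
    {d : ℕ} (hZ : ∀ z : Z, IsMax z → Order.height z = d) :
    fundamentalCycle Z hfin ∈ cyclesOfDim Z d := by
  intro z hz
  refine hZ z ((hgen z).mp ?_)
  by_contra h
  exact hz (fundamentalCycleFun_eq_zero h)

end FlatPullback

section Chow

variable {k : Type u} [Field k] {X Y Z : SchemeOver k} (d : ℕ)

-- names the deprecated (refuted) constant `flatPullback_mem_ratTrivial` of `SubschemeCycles` as the hypothesis `hrat`
set_option linter.deprecated false in
/-- **hodge.S10** (flat pull-back clause; Fulton, *Intersection Theory*, §1.7; Stacks 02RA).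
Functoriality of flat pull-back on Chow groups, on classes: for flat morphisms `f : X ⟶ Y`,
`g : Y ⟶ Z` of relative dimensions `e`, `e'` between schemes locally of finite type over a field,
`(f ≫ g)^* x = f^* (g^* x)` in `CH_{d+e'+e} X` (up to the transport `ChowGroup.congr` along
`d + e' + e = d + (e' + e)`). Unfolds the prelude's named fact `ChowGroup.flatPullback_comp`
(hypothesis `hcomp`) at a class `x`. The hypothesis `hrat : flatPullback_mem_ratTrivial` (needed to
form `ChowGroup.flatPullback`) is the deprecated locally-finite-type form of Fulton's Thm. 1.7,
which is refuted (`not_flatPullback_mem_ratTrivial`,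
`Literature.AlgebraicGeometry.Motives.SubschemeCyclesFlatPullbackRatProofs`), so this statement is
vacuous; its non-vacuous finite-type counterpart is `ChowGroup.flatPullbackOfFiniteType_comp`
(`Literature.AlgebraicGeometry.Motives.SubschemeCyclesFiniteTypeProofs`). [folklore] -/
theorem chowGroup_flatPullback_comp
    (hcomp : ChowGroup.flatPullback_comp (X := X) (Y := Y) (Z := Z) d)
    (f : X ⟶ Y) (g : Y ⟶ Z) [Flat f.left] [Flat g.left]
    [Flat (f ≫ g).left] [LocallyOfFiniteType f.left] [LocallyOfFiniteType g.left]
    [LocallyOfFiniteType (f ≫ g).left] [LocallyOfFiniteType Y.hom] [LocallyOfFiniteType Z.hom]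
    (hf : locallyFinsupp_flatPullbackFun.{u}) (hdim : flatPullback_mem_cyclesOfDim.{u})
    (hrat : flatPullback_mem_ratTrivial.{u})
    {e e' : ℕ} (he : f.left.IsEquidimensional e) (he' : g.left.IsEquidimensional e')
    (h : (f ≫ g).left.IsEquidimensional (e' + e)) (x : ChowGroup Z.left d) :
    ChowGroup.flatPullback d (f ≫ g) hf hdim hrat h x =
      ChowGroup.congr X.left (Nat.add_assoc d e' e)
        (ChowGroup.flatPullback (d + e') f hf hdim hrat he
          (ChowGroup.flatPullback d g hf hdim hrat he' x)) := by
  rw [hcomp f g hf hdim hrat he he' h]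
  rfl

-- names the deprecated (refuted) constant `flatPullback_mem_ratTrivial` of `SubschemeCycles` as the hypothesis `hrat`
set_option linter.deprecated false in
/-- **hodge.S10** (flat pull-back clause; Fulton, *Intersection Theory*, Prop. 1.7;
Stacks 02RG). Proper push-forward and flat pull-back commute, on classes: for a cartesian square
```
X' -g'→ X
f'↓     ↓f
Y' -g→  Y
```
of schemes locally of finite type over a field with `f` proper and `g` flat of relative
dimension `e`, `g^* (f_* x) = f'_* (g'^* x)` in `CH_{d+e} Y'` for every `x ∈ CH_d X`. Proved by
passing to the quotient in the prelude's cycle-level named fact `pushforward_flatPullback`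
(Fulton Prop. 1.7 as printed, hypothesis `hpp`); `f_*`, `f'_*` on Chow groups need Fulton's
Thm. 1.4 (`map_mem_ratTrivial`, hypotheses `hpush`, `hpush'`). The hypothesis
`hrat : flatPullback_mem_ratTrivial` (needed to form `g^*`, `g'^*` as `ChowGroup.flatPullback`) is
the deprecated locally-finite-type form of Fulton's Thm. 1.7, which is refuted
(`not_flatPullback_mem_ratTrivial`,
`Literature.AlgebraicGeometry.Motives.SubschemeCyclesFlatPullbackRatProofs`), so this statement is
vacuous; its non-vacuous finite-type counterpart is `ChowGroup.pushforward_flatPullbackOfFiniteType`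
(`Literature.AlgebraicGeometry.Motives.SubschemeCyclesFiniteTypeProofs`). [folklore] -/
theorem chowGroup_pushforward_flatPullback {e : ℕ} (hpp : pushforward_flatPullback.{u})
    (hpush : map_mem_ratTrivial d (k := k)) (hpush' : map_mem_ratTrivial (d + e) (k := k))
    (hf : locallyFinsupp_flatPullbackFun.{u}) (hdim : flatPullback_mem_cyclesOfDim.{u})
    (hrat : flatPullback_mem_ratTrivial.{u}) {X' Y' : SchemeOver k} (f : X ⟶ Y) (g : Y' ⟶ Y)
    (f' : X' ⟶ Y') (g' : X' ⟶ X) (H : IsPullback g'.left f'.left f.left g.left)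
    [IsProper f.left] [IsProper f'.left] [Flat g.left] [Flat g'.left]
    [LocallyOfFiniteType g.left] [LocallyOfFiniteType g'.left] [LocallyOfFiniteType X.hom]
    [LocallyOfFiniteType Y.hom] [LocallyOfFiniteType X'.hom] [LocallyOfFiniteType Y'.hom]
    (he : g.left.IsEquidimensional e) (he' : g'.left.IsEquidimensional e)
    (x : ChowGroup X.left d) :
    ChowGroup.flatPullback d g hf hdim hrat he (ChowGroup.pushforward d hpush f x) =
      ChowGroup.pushforward (d + e) hpush' f' (ChowGroup.flatPullback d g' hf hdim hrat he' x) := by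
  induction x using QuotientAddGroup.induction_on with
  | H c =>
    change ChowGroup.flatPullback d g hf hdim hrat he
        (ChowGroup.pushforward d hpush f (ChowGroup.mk X.left d c)) =
      ChowGroup.pushforward (d + e) hpush' f'
        (ChowGroup.flatPullback d g' hf hdim hrat he' (ChowGroup.mk X.left d c))
    rw [ChowGroup.pushforward_mk, ChowGroup.flatPullback_mk, ChowGroup.flatPullback_mk,
      ChowGroup.pushforward_mk]
    congr 1
    apply Subtype.ext
    simp only [coe_cyclesOfDimFlatPullback, coe_cyclesOfDimMap]
    exact hpp f g f' g' H hf he he' c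

end Chow

section Comap

/-- **hodge.S10** (base change of cycle classes; Fulton, *Intersection Theory*, Ex. 6.1.2;
EGA IV₂ 4.6.1). Over a perfect field `k`, the cycle class of `closure {z}` in the pulled-back
theory `W.comap σ` (the multiplicity-one sum `∑_{z' over z} cl(closure {z'})` of prelude
`BaseChange`) is the class in `W` of the honest base-changed cycle `π^*[closure {z}]` on `X_σ`
(prelude `SubschemeCycles`): for `k` perfect, `κ(z) ⊗_k L` is reduced, so all components of
`closure {z} ×_k Spec L` have multiplicity `1` (EGA IV₂ 4.6.1: over a perfect field every
reduced scheme is geometrically reduced). A comparison between the two H21 constructions; the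
mathematical content is EGA IV₂ 4.6.1 with Fulton Ex. 6.1.2 (base change of cycles). Named fact,
with the prelude's local-finiteness fact `hπ` as an explicit hypothesis. [cite: GrothendieckDieudonne1965, Prop. 4.6.1] -/
def comap_cycleClass_eq_cycleMap_baseChange : Prop :=
  ∀ {k L : Type u} [Field k] [Field L] {K : Type v} [Field K] [PerfectField k]
    (W : PreWeilCohomology L K) (σ : k →+* L) (X : SchemeOver k) [LocallyOfFiniteType X.hom]
    (hπ : locallyFinsupp_flatPullbackFun_baseChangeHomFst.{u}) (p : ℕ) (z : X.left),
    (W.comap σ).cycleClass X p z =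
      W.cycleMap ((baseChangeHom σ).obj X) p (AlgebraicCycle.baseChange σ X hπ (primeCycle z))

end Comap

/-! ### hodge.S11: adequate equivalence relations -/

section Adequate

variable {k : Type u} [Field k] {K : Type v} [Field K] [CharZero K]

/-- **hodge.S11** (`Rat ≤ Alg`; Fulton, *Intersection Theory*, §10.3, Ex. 10.3.2; Kleiman 1968
§3.1). On a scheme locally of finite type over a field, rationally trivial `d`-cycles are
algebraically trivial, inside `Z_d X`. Restates the prelude's named fact `ratTrivial_le_algTrivial`
(hypothesis `hRA`) inside `Z_d X`. [cite: Kleiman1968, §3.1] -/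
theorem ratTrivial_le_algTrivial' (X : SchemeOver k) [LocallyOfFiniteType X.hom] (d : ℕ)
    (hRA : ratTrivial_le_algTrivial X d) :
    (ratTrivial X.left d).addSubgroupOf (cyclesOfDim X.left d) ≤
      (algTrivial X d).addSubgroupOf (cyclesOfDim X.left d) :=
  fun _ hc ↦ AddSubgroup.mem_addSubgroupOf.mpr (hRA (AddSubgroup.mem_addSubgroupOf.mp hc))

/-- **hodge.S11** (algebraic equivalence, definitional; Fulton, *Intersection Theory*, §10.3,
Ex. 10.3.2). A cycle is algebraically equivalent to zero iff it lies in the subgroup generated by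
the differences `[W_{t₀}] - [W_{t₁}]` of fibres of flat families of `(d+1)`-dimensional
subvarieties of `X × T` over smooth integral curves `T` at rational points `t₀, t₁ ∈ T(k)`. [folklore] -/
theorem mem_algTrivial_iff (X : SchemeOver k) (d : ℕ) (c : AlgebraicCycle X.left ℤ) :
    c ∈ algTrivial X d ↔ c ∈ AddSubgroup.closure (algEquivGenerators X d) :=
  Iff.rfl

variable (W : WeilCohomology k K) {n : ℕ} {X : SchemeOver k} [CompactSpace X.left]
  (hX : IsSmoothProjective n X) (p d : ℕ) (h : p + d = n)

/-- **hodge.S11** (`Alg ≤ Hom`; Fulton, *Intersection Theory*, §19.1, Ex. 19.1.11; Kleiman 1968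
Prop. 3.2). Under the hypothesis `hW : W.AlgTrivialLeHomTrivial` — a **theorem** for the Betti,
`ℓ`-adic étale and algebraic de Rham realizations (the cycle class is locally constant in flat
families over a connected base), but not a consequence of the axioms of `Literature.AlgebraicGeometry.Motives.WeilCohomology` —
algebraically trivial `d`-cycles on a smooth projective `X` of dimension `p + d` are homologically
trivial. Unfolds the hypothesis. [cite: Kleiman1968, Prop. 3.2] -/
theorem algTrivial_le_homTrivial_of (hW : W.AlgTrivialLeHomTrivial) :
    (algTrivial X d).addSubgroupOf (cyclesOfDim X.left d) ≤ W.homTrivial hX p d h :=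
  hW hX p d h

/-- **hodge.S11** (`Hom ≤ Num`; Kleiman 1968 Prop. 3.2 (i); Fulton, *Intersection Theory*,
§19.3.1). On a smooth projective `X` of dimension `p + d`, a homologically trivial `d`-cycle is
numerically trivial: `tr(γ(c) ∪ γ(c')) = 0` for all `c'` once `γ(c) = 0`. [cite: Kleiman1968, Prop. 3.2 (i] -/
theorem homTrivial_le_numTrivial' {c : ↥(cyclesOfDim X.left d)} (hc : c ∈ W.homTrivial hX p d h) :
    c ∈ W.numTrivial hX p d h :=
  W.homTrivial_le_numTrivial hX p d h hc

/-- **hodge.S11** (the chain `Rat ≤ Alg ≤ Hom ≤ Num ≤ Z_d`; Fulton, *Intersection Theory*,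
Ch. 19; Kleiman 1968 §3). On a smooth projective `X` of dimension `p + d` over a field, for a
Weil cohomology theory satisfying `Alg ≤ Hom`, the four adequate equivalence relations form a
chain of subgroups of `Z_d X` (given `Rat ≤ Alg`, the named fact `ratTrivial_le_algTrivial`, as
`hRA`). [cite: Kleiman1968, §3] -/
theorem ratTrivial_le_algTrivial_le_homTrivial_le_numTrivial [LocallyOfFiniteType X.hom]
    (hRA : ratTrivial_le_algTrivial X d) (hW : W.AlgTrivialLeHomTrivial) :
    (ratTrivial X.left d).addSubgroupOf (cyclesOfDim X.left d) ≤
        (algTrivial X d).addSubgroupOf (cyclesOfDim X.left d) ∧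
      (algTrivial X d).addSubgroupOf (cyclesOfDim X.left d) ≤ W.homTrivial hX p d h ∧
      W.homTrivial hX p d h ≤ W.numTrivial hX p d h :=
  ⟨ratTrivial_le_algTrivial' X d hRA, algTrivial_le_homTrivial_of W hX p d h hW,
    W.homTrivial_le_numTrivial hX p d h⟩

end Adequate

section Griffiths

/-- **hodge.S11** (Griffiths' theorem, as a statement; Griffiths, *On the periods of certain
rational integrals II*, Ann. of Math. 90 (1969), §14; Voisin, *Hodge Theory II*, Thm. 8.24).
For the Weil cohomology theory `W` on complex varieties: *there is a smooth projective complex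
variety whose Griffiths group `Hom / Alg` contains a non-torsion element* — so homological and
algebraic equivalence differ, even rationally. Griffiths' example is a general quintic
hypersurface `X ⊆ ℙ⁴` (`n = 3`) and the difference of two lines on it (`d = 1`, `p = 2`), for
Betti cohomology; the statement is phrased without hypersurface vocabulary and parametrised by
`W` (a theorem for `W` = Betti cohomology with `ℚ`-coefficients). The witness `CompactSpace X.left`
is bookkeeping (it follows from `hX`, named fact `IsSmoothProjective.compactSpace`). [folklore] -/
def GriffithsGroupNontrivialStatement (W : WeilCohomology ℂ ℚ) : Prop :=
  ∃ (n : ℕ) (X : SchemeOver ℂ) (_ : CompactSpace X.left) (hX : IsSmoothProjective n X) (p d : ℕ)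
    (h : p + d = n), ∃ x : W.griffithsGroup hX p d h, ¬ IsOfFinAddOrder x

end Griffiths

section Matsusaka

variable {k : Type u} [Field k] {K : Type v} [Field K] [CharZero K]

/-- **hodge.S11** (Matsusaka's theorem, as a statement; T. Matsusaka, *The criteria for
algebraic equivalence and the torsion group*, Amer. J. Math. 79 (1957); Fulton, *Intersection
Theory*, Ex. 19.3.1, §19.3.1). For divisors, algebraic and numerical equivalence agree up to
torsion, `Alg^1(X) ⊗ ℚ = Num^1(X) ⊗ ℚ`: on every smooth projective `X` of dimension `n = 1 + d`,
every numerically trivial `d`-cycle (divisor) has a nonzero multiple algebraically equivalent to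
zero. Numerical equivalence is computed through `W` (`WeilCohomology.numTrivial`); this is a
theorem for the classical theories. [folklore] -/
def MatsusakaStatement (W : WeilCohomology k K) : Prop :=
  ∀ ⦃n : ℕ⦄ ⦃X : SchemeOver k⦄ [CompactSpace X.left] (hX : IsSmoothProjective n X) (d : ℕ)
    (h : 1 + d = n)
    (c : ↥(cyclesOfDim X.left d)), c ∈ W.numTrivial hX 1 d h →
      ∃ N : ℕ, N ≠ 0 ∧ N • (c : AlgebraicCycle X.left ℤ) ∈ algTrivial X d

end Matsusaka

end Hodge

end Literature.AlgebraicGeometry.Motives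

end
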